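import Literature.Analysis.OperatorTheory.NelsonSumOfSquares
import HarnessLib

/-!
# Nelson's sum-of-squares recursion in a-priori form: weighted, almost skew-symmetric families

This is the *a-priori* companion of `Literature.Analysis.OperatorTheory.NelsonSumOfSquares`.
There, a finite family `(A_i)` of **skew-symmetric** operators on an inner product space, closed
under commutators, with Laplacian `Δ = ∑ A_i²` stabilising a finite-dimensional subspace `T`,
gives factorial bounds `‖A_α w‖ ≤ Mⁿ n! ‖w‖` for the words `A_α` on `T` (Nelson 1959). Here the
operators `A_i` act on a bare complex vector space `V` (think: smooth functions on a Lie group,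
`A_i` the left-invariant vector fields of a basis, so that nothing is known to be square
integrable), and the Hilbert space enters only through a sequence of linear "weight" maps
`M_m : V → H` (think: `M_m f = χ^{m+1} f ∈ L²`, `χ` a compactly supported cut-off, so that
`M_m f` is always in `L²`) which are

* monotone: `‖M_{m+1} f‖ ≤ ‖M_m f‖` (`0 ≤ χ ≤ 1`), and
* almost skew: `|⟪M_m (A_i f), M_m g⟫ + ⟪M_m f, M_m (A_i g)⟫| ≤ D (m+1) ‖M_{m-1} f‖ ‖M_m g‖` for
  `m ≥ 1` (integration by parts: the defect is the derivative of the cut-off, which costs one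
  power of `χ`, put on the lower-order factor `f`, plus possibly a divergence constant).

**Theorem** (`norm_weight_wordEnd_le`). If `T ≤ V` is a subspace with `Δ T ⊆ T`, `N` is a
nonnegative function on `T` with `‖M_0 w‖ ≤ N w` and `N (Δ w) ≤ B N w` on `T` (e.g. any norm on a
finite-dimensional `T`), then for every word `α` of length `n`, every `m ≥ n` and every `w ∈ T`,

  `‖M_m (A_α w)‖ ≤ R(n, m) · N w`

with an explicit finite constant `R(n, m) = aprioriBound B c d D n m` (recursion
`R(n+1, m) = (√B + 2 n d² c + d D (m+1)) · max (R(n,m)) (R(n,m-1))`, `R(0, m) = 1`). In the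
application this says: all derivatives of the elements of a finite-dimensional `Δ`-stable space
of smooth functions are *locally square integrable with the local bounds of the functions
themselves* — the input of the uniform moderate growth of `K`-finite `Z(𝔤)`-finite automorphic
forms in stable spaces (`Literature/NumberTheory/Automorphic`), replacing elliptic regularity.

The proof is Nelson's one-line recursion (as in `NelsonSumOfSquares.norm_wordOp_succ_le`) run with
the weights: for the maximal word `A_j A_α` of length `n+1` at `w` and weight `m`,
`‖M_m A_j A_α w‖² ≤ ∑_i ‖M_m A_i f‖²` (`f = A_α w`), and by almost-skewness
`∑_i ‖M_m A_i f‖² ≤ |⟪M_m f, M_m Δ f⟫| + D (m+1) ‖M_{m-1} f‖ ∑_i ‖M_m A_i f‖`, where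
`Δ f = A_α Δ w + [Δ, A_α] w` and `[Δ, A_α]` is a sum of `2 n d²` words of length `n + 1`
(`norm_weight_wordEnd_commLaplacianEnd_le`); the weight `m - 1 ≥ n` on the lower-order factor
`f` is covered by the induction hypothesis, so the recursion closes:
`x² ≤ B (R N w)² + (2 n d² c R + d D (m+1) R') (N w) x`.

Everything here is proved; the definitions are the word operators `wordEnd`, the Laplacian
`laplacianEnd`, the commutator `commLaplacianEnd` (copies for a bare module of the notions of
`NelsonSumOfSquares`, which are typed over an inner product space) and the bound `aprioriBound`;
the elementary inequality `le_of_sq_le_add_mul` is imported from `NelsonSumOfSquares`.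

## References

* E. Nelson, *Analytic vectors*, Ann. of Math. 70 (1959), 572–615, §6 (the estimates
  `‖X_i X_j u‖ ≤ c ‖(Δ - b) u‖` and their iterates) [Nelson1959] (not held).
* M. P. Gaffney, *A special Stokes's theorem for complete Riemannian manifolds*, Ann. of Math. 60
  (1954), 140–145 (the cut-off argument `∫ χ² |∇u|² ≤ 2 ∫ |Δu| |u| + 4 ∫ |∇χ|² |u|²`) (not held).
* Harish-Chandra, *Representations of a semisimple Lie group on a Banach space. I*, Trans. AMS 75
  (1953), Lemma 34 (p. 228) [HarishChandraTAMS1953] (held): the application.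
-/

open scoped InnerProductSpace
open Finset

noncomputable section

namespace Literature.Analysis.OperatorTheory

variable {V : Type*} [AddCommGroup V] [Module ℂ V]
  {H : Type*} [NormedAddCommGroup H] [InnerProductSpace ℂ H] {ι : Type*}

/-! ## Word operators, Laplacian and commutator on a bare module -/

/-- The word operator `A_α = A_{α₁} ∘ ⋯ ∘ A_{αₙ}` of a list `α` on a complex vector space (the empty
word acts as the identity). Nelson 1959. [folklore] -/
def wordEnd (A : ι → Module.End ℂ V) (α : List ι) : Module.End ℂ V :=
  (α.map A).prod

/-- `A_{[]} = 1`. [folklore] -/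
@[simp] theorem wordEnd_nil (A : ι → Module.End ℂ V) : wordEnd A [] = 1 := by
  simp [wordEnd]

/-- `A_{i :: α} = A_i ∘ A_α`. [folklore] -/
@[simp]
theorem wordEnd_cons (A : ι → Module.End ℂ V) (i : ι) (α : List ι) :
    wordEnd A (i :: α) = A i * wordEnd A α := by
  simp [wordEnd]

/-- `A_{α ++ β} = A_α ∘ A_β`. [folklore] -/
theorem wordEnd_append (A : ι → Module.End ℂ V) (α β : List ι) :
    wordEnd A (α ++ β) = wordEnd A α * wordEnd A β := by
  simp [wordEnd, List.map_append, List.prod_append]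

/-- `A_{[i]} = A_i`. [folklore] -/
@[simp] theorem wordEnd_singleton (A : ι → Module.End ℂ V) (i : ι) : wordEnd A [i] = A i := by
  simp [wordEnd]

variable [Fintype ι]

/-- Nelson's Laplacian `Δ = ∑_i A_i²` of the family `A` (on a bare module). Nelson 1959. [folklore] -/
def laplacianEnd (A : ι → Module.End ℂ V) : Module.End ℂ V :=
  ∑ i, A i * A i

/-- `Δ u = ∑_i A_i (A_i u)`. [folklore] -/
theorem laplacianEnd_apply (A : ι → Module.End ℂ V) (u : V) :
    laplacianEnd A u = ∑ i, A i (A i u) := by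
  simp [laplacianEnd, LinearMap.sum_apply]

/-- The commutator `[Δ, A_α] = Δ A_α - A_α Δ`. [folklore] -/
def commLaplacianEnd (A : ι → Module.End ℂ V) (α : List ι) : Module.End ℂ V :=
  laplacianEnd A * wordEnd A α - wordEnd A α * laplacianEnd A

/-- `[Δ, A_j] = ∑_i ∑_m c_{ijm} (A_i A_m + A_m A_i)` when `A_i A_j - A_j A_i = ∑_m c_{ijm} A_m`.
Nelson 1959 (`ad X (Δ)`). [folklore] -/
theorem commLaplacianEnd_singleton (A : ι → Module.End ℂ V) (c : ι → ι → ι → ℝ)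
    (hbr : ∀ i m, A i * A m - A m * A i = ∑ l, (c i m l : ℂ) • A l) (j : ι) :
    commLaplacianEnd A [j] = ∑ i, ∑ m, (c i j m : ℂ) • (A i * A m + A m * A i) := by
  have key : ∀ i, A i * A i * A j - A j * (A i * A i) =
      A i * (A i * A j - A j * A i) + (A i * A j - A j * A i) * A i := fun i ↦ by
    noncomm_ring
  simp only [commLaplacianEnd, wordEnd_singleton, laplacianEnd, Finset.sum_mul, Finset.mul_sum,
    ← Finset.sum_sub_distrib, key, hbr, smul_add, Finset.sum_add_distrib, mul_smul_comm,
    smul_mul_assoc]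

/-- The recursion `[Δ, A_{j :: α}] = [Δ, A_j] A_α + A_j [Δ, A_α]`. [folklore] -/
theorem commLaplacianEnd_cons (A : ι → Module.End ℂ V) (j : ι) (α : List ι) :
    commLaplacianEnd A (j :: α) =
      commLaplacianEnd A [j] * wordEnd A α + A j * commLaplacianEnd A α := by
  simp only [commLaplacianEnd, wordEnd_cons, wordEnd_nil, mul_one]
  noncomm_ring

/-- **The commutator estimate, read through a linear map `L : V → H`.** If every word `β` of
length `|α| + 1` satisfies `‖L (A_p (A_β w))‖ ≤ x` for the fixed prefix `p`, then
`‖L (A_p ([Δ, A_α] w))‖ ≤ 2 |α| d² c x` (`[Δ, A_α]` is a sum of `2 |α| d²` words of length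
`|α| + 1` with coefficients bounded by `c`). Nelson 1959 (estimates of `(ad X)ⁿ Δ`). [folklore] -/
theorem norm_map_wordEnd_commLaplacianEnd_le (A : ι → Module.End ℂ V) (c : ι → ι → ι → ℝ)
    (hbr : ∀ i m, A i * A m - A m * A i = ∑ l, (c i m l : ℂ) • A l) {cM : ℝ}
    (hc : ∀ i m l, |c i m l| ≤ cM) (L : V →ₗ[ℂ] H) (α p : List ι) (w : V) {x : ℝ}
    (hx : ∀ β : List ι, β.length = α.length + 1 → ‖L (wordEnd A (p ++ β) w)‖ ≤ x) :
    ‖L (wordEnd A p (commLaplacianEnd A α w))‖ ≤ 2 * α.length * (Fintype.card ι) ^ 2 * cM * x := by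
  induction α generalizing p with
  | nil =>
    have h0 : commLaplacianEnd A [] = 0 := by simp [commLaplacianEnd]
    simp [h0]
  | cons j α ih =>
    have hcM : 0 ≤ cM := (abs_nonneg _).trans (hc j j j)
    rw [commLaplacianEnd_cons, LinearMap.add_apply, map_add, map_add, Module.End.mul_apply,
      Module.End.mul_apply]
    refine (norm_add_le _ _).trans ?_
    -- first piece: `L A_p ([Δ, A_j] (A_α w))`, `2 d²` words of length `|α| + 2`
    have h1 : ‖L (wordEnd A p (commLaplacianEnd A [j] (wordEnd A α w)))‖ ≤
        2 * (Fintype.card ι) ^ 2 * cM * x := by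
      rw [commLaplacianEnd_singleton A c hbr j]
      simp only [LinearMap.sum_apply, LinearMap.smul_apply, LinearMap.add_apply,
        Module.End.mul_apply, map_sum, map_smul, map_add]
      calc ‖∑ i, ∑ m, (c i j m : ℂ) • (L (wordEnd A p (A i (A m (wordEnd A α w)))) +
              L (wordEnd A p (A m (A i (wordEnd A α w)))))‖
          ≤ ∑ i, ∑ m, ‖(c i j m : ℂ) • (L (wordEnd A p (A i (A m (wordEnd A α w)))) +
              L (wordEnd A p (A m (A i (wordEnd A α w)))))‖ :=
            (norm_sum_le _ _).trans (Finset.sum_le_sum fun i _ ↦ norm_sum_le _ _)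
        _ ≤ ∑ _i : ι, ∑ _m : ι, cM * (x + x) := by
            refine Finset.sum_le_sum fun i _ ↦ Finset.sum_le_sum fun m _ ↦ ?_
            rw [norm_smul]
            refine mul_le_mul ?_ ((norm_add_le _ _).trans (add_le_add ?_ ?_)) (norm_nonneg _) hcM
            · rw [Complex.norm_real, Real.norm_eq_abs]
              exact hc i j m
            · have := hx (i :: m :: α) (by simp)
              rwa [wordEnd_append, wordEnd_cons, wordEnd_cons, Module.End.mul_apply,
                Module.End.mul_apply, Module.End.mul_apply] at this
            · have := hx (m :: i :: α) (by simp)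
              rwa [wordEnd_append, wordEnd_cons, wordEnd_cons, Module.End.mul_apply,
                Module.End.mul_apply, Module.End.mul_apply] at this
        _ = 2 * (Fintype.card ι) ^ 2 * cM * x := by
            simp only [Finset.sum_const, Finset.card_univ]
            ring
    -- second piece: `L A_{p ++ [j]} ([Δ, A_α] w)`, by induction with the longer prefix
    have h2 : ‖L (wordEnd A p (A j (commLaplacianEnd A α w)))‖ ≤
        2 * α.length * (Fintype.card ι) ^ 2 * cM * x := by
      have := ih (p ++ [j]) fun β hβ ↦ by
        have h := hx (j :: β) (by simp [hβ])
        rwa [show p ++ j :: β = p ++ [j] ++ β by simp] at h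
      rwa [wordEnd_append, wordEnd_singleton, Module.End.mul_apply] at this
    refine (add_le_add h1 h2).trans (le_of_eq ?_)
    simp only [List.length_cons, Nat.cast_add, Nat.cast_one]
    ring

/-! ## The weighted recursion -/

/-- **The weighted recursion.** Let `M_m : V → H` be monotone and almost skew for the family `A`
(defect constant `D`), `T` a `Δ`-stable subspace with a nonnegative size function `N`,
`N (Δ w) ≤ B N w` on `T`. If all words of length `n` satisfy `‖M_m A_α w‖ ≤ R N w` and
`‖M_{m-1} A_α w‖ ≤ R' N w` on `T` (with `n + 1 ≤ m`), then every word `β` of length `n + 1`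
satisfies `‖M_m A_β w‖ ≤ (√B + 2 n d² c + d D (m+1)) · max R R' · N w` on `T`. Nelson 1959, §6,
with Gaffney's cut-off. [folklore] -/
theorem norm_weight_wordEnd_succ_le (A : ι → Module.End ℂ V) (c : ι → ι → ι → ℝ)
    (hbr : ∀ i m, A i * A m - A m * A i = ∑ l, (c i m l : ℂ) • A l) {cM : ℝ}
    (hc : ∀ i m l, |c i m l| ≤ cM) (M : ℕ → V →ₗ[ℂ] H) {D : ℝ} (hD : 0 ≤ D)
    (hdef : ∀ m : ℕ, 1 ≤ m → ∀ (i : ι) (f g : V),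
      ‖⟪M m (A i f), M m g⟫_ℂ + ⟪M m f, M m (A i g)⟫_ℂ‖ ≤ D * (m + 1) * ‖M (m - 1) f‖ * ‖M m g‖)
    {T : Submodule ℂ V} (hT : ∀ w ∈ T, laplacianEnd A w ∈ T) (N : V → ℝ)
    (hN : ∀ w ∈ T, 0 ≤ N w) {B : ℝ} (hB0 : 0 ≤ B) (hB : ∀ w ∈ T, N (laplacianEnd A w) ≤ B * N w)
    {n m : ℕ} (hnm : n + 1 ≤ m) {R R' : ℝ} (hR0 : 0 ≤ R) (hR'0 : 0 ≤ R')
    (hR : ∀ α : List ι, α.length = n → ∀ w ∈ T, ‖M m (wordEnd A α w)‖ ≤ R * N w)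
    (hR' : ∀ α : List ι, α.length = n → ∀ w ∈ T, ‖M (m - 1) (wordEnd A α w)‖ ≤ R' * N w)
    (β : List ι) (hβ : β.length = n + 1) {w : V} (hw : w ∈ T) :
    ‖M m (wordEnd A β w)‖ ≤
      (Real.sqrt B + 2 * n * (Fintype.card ι) ^ 2 * cM + (Fintype.card ι) * D * (m + 1)) *
        max R R' * N w := by
  classical
  have hcM : 0 ≤ cM := by
    obtain ⟨j, -⟩ := List.exists_mem_of_length_eq_add_one hβ
    exact (abs_nonneg _).trans (hc j j j)
  have hm1 : 1 ≤ m := le_trans (Nat.le_add_left 1 n) hnm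
  have hNw : 0 ≤ N w := hN w hw
  -- the maximal word of length `n + 1` at `w`, weight `m`
  obtain ⟨v₀, -, hv₀⟩ := Finset.exists_max_image (Finset.univ : Finset (List.Vector ι (n + 1)))
    (fun v ↦ ‖M m (wordEnd A v.1 w)‖) ⟨⟨β, hβ⟩, Finset.mem_univ _⟩
  set x := ‖M m (wordEnd A v₀.1 w)‖ with hx_def
  have hxβ : ∀ γ : List ι, γ.length = n + 1 → ‖M m (wordEnd A γ w)‖ ≤ x := fun γ hγ ↦
    hv₀ ⟨γ, hγ⟩ (Finset.mem_univ _)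
  have hx0 : 0 ≤ x := norm_nonneg _
  -- `v₀ = j :: α` with `|α| = n`
  obtain ⟨j, α, hjα⟩ : ∃ j α, v₀.1 = j :: α := by
    match h : v₀.1 with
    | [] => exact absurd (h ▸ v₀.2) (by simp)
    | j :: α => exact ⟨j, α, rfl⟩
  have hα : α.length = n := by
    have := v₀.2
    rw [hjα, List.length_cons] at this
    omega
  set f : V := wordEnd A α w with hf
  -- the induction hypotheses at `w`, `Δ w`
  have hu : ‖M m f‖ ≤ R * N w := hR α hα w hw
  have hu' : ‖M (m - 1) f‖ ≤ R' * N w := hR' α hα w hw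
  have hΔ : ‖M m (wordEnd A α (laplacianEnd A w))‖ ≤ R * (B * N w) :=
    (hR α hα _ (hT w hw)).trans (mul_le_mul_of_nonneg_left (hB w hw) hR0)
  have hxj : x = ‖M m (A j f)‖ := by
    rw [hx_def, hjα, wordEnd_cons, Module.End.mul_apply]
  -- words `A_i A_α w` are bounded by `x`
  have hxi : ∀ i, ‖M m (A i f)‖ ≤ x := fun i ↦ by
    have := hxβ (i :: α) (by simp [hα])
    rwa [wordEnd_cons, Module.End.mul_apply] at this
  -- the sum of squares through almost-skewness
  have hsum : ∑ i, ‖M m (A i f)‖ ^ 2 ≤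
      ‖⟪M m f, M m (laplacianEnd A f)⟫_ℂ‖ + ∑ i, D * (m + 1) * ‖M (m - 1) f‖ * ‖M m (A i f)‖ := by
    have hterm : ∀ i, ‖M m (A i f)‖ ^ 2 ≤
        -RCLike.re ⟪M m f, M m (A i (A i f))⟫_ℂ + D * (m + 1) * ‖M (m - 1) f‖ * ‖M m (A i f)‖ := by
      intro i
      have hd := hdef m hm1 i f (A i f)
      have e : (‖M m (A i f)‖ ^ 2 : ℝ) = RCLike.re ⟪M m (A i f), M m (A i f)⟫_ℂ := by
        rw [← inner_self_eq_norm_sq (𝕜 := ℂ)]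
      have hre : RCLike.re (⟪M m (A i f), M m (A i f)⟫_ℂ + ⟪M m f, M m (A i (A i f))⟫_ℂ) ≤
          D * (m + 1) * ‖M (m - 1) f‖ * ‖M m (A i f)‖ :=
        (RCLike.re_le_norm _).trans hd
      rw [map_add] at hre
      rw [e]
      linarith
    have hlap : ∑ i, -RCLike.re ⟪M m f, M m (A i (A i f))⟫_ℂ =
        -RCLike.re ⟪M m f, M m (laplacianEnd A f)⟫_ℂ := by
      rw [laplacianEnd_apply, map_sum, inner_sum, map_sum, Finset.sum_neg_distrib]
    calc ∑ i, ‖M m (A i f)‖ ^ 2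
        ≤ ∑ i, (-RCLike.re ⟪M m f, M m (A i (A i f))⟫_ℂ +
            D * (m + 1) * ‖M (m - 1) f‖ * ‖M m (A i f)‖) := Finset.sum_le_sum fun i _ ↦ hterm i
      _ = -RCLike.re ⟪M m f, M m (laplacianEnd A f)⟫_ℂ +
            ∑ i, D * (m + 1) * ‖M (m - 1) f‖ * ‖M m (A i f)‖ := by
          rw [Finset.sum_add_distrib, hlap]
      _ ≤ _ := add_le_add ((neg_le_abs _).trans (RCLike.abs_re_le_norm _)) le_rfl
  -- the key inequality `x² ≤ B (R N w)² + (2 n d² c R + d D (m+1) R') (N w) x`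
  have hkey : x ^ 2 ≤ B * (max R R' * N w) ^ 2 +
      (2 * n * (Fintype.card ι) ^ 2 * cM + (Fintype.card ι) * D * (m + 1)) * (max R R' * N w) * x := by
    have hRle : R ≤ max R R' := le_max_left _ _
    have hR'le : R' ≤ max R R' := le_max_right _ _
    have hρ0 : 0 ≤ max R R' * N w := mul_nonneg (hR0.trans hRle) hNw
    -- `x² ≤ ∑_i ‖M_m A_i f‖²`
    have h1 : x ^ 2 ≤ ∑ i, ‖M m (A i f)‖ ^ 2 := by
      rw [hxj]
      exact Finset.single_le_sum (f := fun i ↦ ‖M m (A i f)‖ ^ 2) (fun i _ ↦ sq_nonneg _)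
        (Finset.mem_univ j)
    refine h1.trans (hsum.trans ?_)
    -- `Δ f = A_α (Δ w) + [Δ, A_α] w`
    have hsplit : laplacianEnd A f = wordEnd A α (laplacianEnd A w) + commLaplacianEnd A α w := by
      simp [commLaplacianEnd, hf]
    have hcomm : ‖M m (commLaplacianEnd A α w)‖ ≤ 2 * n * (Fintype.card ι) ^ 2 * cM * x := by
      have := norm_map_wordEnd_commLaplacianEnd_le A c hbr hc (M m) α [] w (x := x) fun γ hγ ↦
        hxβ γ (by rw [hγ, hα])
      simpa [hα] using this
    have hinner : ‖⟪M m f, M m (laplacianEnd A f)⟫_ℂ‖ ≤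
        (R * N w) * (R * (B * N w)) + (R * N w) * (2 * n * (Fintype.card ι) ^ 2 * cM * x) := by
      rw [hsplit, map_add, inner_add_right]
      refine (norm_add_le _ _).trans (add_le_add ?_ ?_)
      · exact (norm_inner_le_norm _ _).trans
          (mul_le_mul hu hΔ (norm_nonneg _) (mul_nonneg hR0 hNw))
      · exact (norm_inner_le_norm _ _).trans
          (mul_le_mul hu hcomm (norm_nonneg _) (mul_nonneg hR0 hNw))
    have hdefect : ∑ i, D * (m + 1) * ‖M (m - 1) f‖ * ‖M m (A i f)‖ ≤
        (Fintype.card ι) * (D * (m + 1) * (R' * N w) * x) := by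
      calc ∑ i, D * (m + 1) * ‖M (m - 1) f‖ * ‖M m (A i f)‖
          ≤ ∑ _i : ι, D * (m + 1) * (R' * N w) * x := by
            refine Finset.sum_le_sum fun i _ ↦ ?_
            have hDm : 0 ≤ D * (m + 1) := by positivity
            exact mul_le_mul (mul_le_mul_of_nonneg_left hu' hDm) (hxi i) (norm_nonneg _)
              (mul_nonneg hDm (mul_nonneg hR'0 hNw))
        _ = (Fintype.card ι) * (D * (m + 1) * (R' * N w) * x) := by
            simp only [Finset.sum_const, Finset.card_univ, nsmul_eq_mul]
    refine (add_le_add hinner hdefect).trans ?_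
    -- replace `R`, `R'` by their maximum
    have hm0 : (0 : ℝ) ≤ m + 1 := by positivity
    have hd0 : (0 : ℝ) ≤ Fintype.card ι := by positivity
    have e1 : (R * N w) * (R * (B * N w)) ≤ B * (max R R' * N w) ^ 2 := by
      have : R * N w ≤ max R R' * N w := mul_le_mul_of_nonneg_right hRle hNw
      have hsq : (R * N w) ^ 2 ≤ (max R R' * N w) ^ 2 := pow_le_pow_left₀ (mul_nonneg hR0 hNw) this 2
      calc (R * N w) * (R * (B * N w)) = B * (R * N w) ^ 2 := by ring
        _ ≤ B * (max R R' * N w) ^ 2 := mul_le_mul_of_nonneg_left hsq hB0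
    have e2 : (R * N w) * (2 * n * (Fintype.card ι) ^ 2 * cM * x) ≤
        (2 * n * (Fintype.card ι) ^ 2 * cM) * (max R R' * N w) * x := by
      have : R * N w ≤ max R R' * N w := mul_le_mul_of_nonneg_right hRle hNw
      have h2 : 0 ≤ 2 * (n : ℝ) * (Fintype.card ι) ^ 2 * cM * x := by positivity
      nlinarith
    have e3 : (Fintype.card ι) * (D * (m + 1) * (R' * N w) * x) ≤
        ((Fintype.card ι) * D * (m + 1)) * (max R R' * N w) * x := by
      have : R' * N w ≤ max R R' * N w := mul_le_mul_of_nonneg_right hR'le hNw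
      have h3 : 0 ≤ (Fintype.card ι : ℝ) * D * (m + 1) * x := by positivity
      nlinarith
    nlinarith
  have hb : 0 ≤ 2 * (n : ℝ) * (Fintype.card ι) ^ 2 * cM + (Fintype.card ι) * D * (m + 1) := by
    positivity
  have hρ0 : 0 ≤ max R R' * N w := mul_nonneg (hR0.trans (le_max_left _ _)) hNw
  have := le_of_sq_le_add_mul hρ0 hB0 hb hkey
  calc ‖M m (wordEnd A β w)‖ ≤ x := hxβ β hβ
    _ ≤ _ := this
    _ = _ := by ring

/-- The recursively defined a-priori bounds: `R(0, m) = 1`,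
`R(n+1, m) = (√B + 2 n d² c + d D (m+1)) · max (R(n, m)) (R(n, m-1))`. [folklore] -/
def aprioriBound (B cM : ℝ) (d : ℕ) (D : ℝ) : ℕ → ℕ → ℝ
  | 0, _ => 1
  | n + 1, m => (Real.sqrt B + 2 * n * (d : ℝ) ^ 2 * cM + d * D * (m + 1)) *
      max (aprioriBound B cM d D n m) (aprioriBound B cM d D n (m - 1))

/-- `0 ≤ R(n, m)`. [folklore] -/
theorem aprioriBound_nonneg {B cM D : ℝ} (hcM : 0 ≤ cM) (hD : 0 ≤ D) (d : ℕ) :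
    ∀ n m, 0 ≤ aprioriBound B cM d D n m := by
  intro n
  induction n with
  | zero => intro m; simp [aprioriBound]
  | succ n ih =>
    intro m
    simp only [aprioriBound]
    exact mul_nonneg (by positivity) ((ih m).trans (le_max_left _ _))

/-- **Nelson's estimate in a-priori form (all words, finite weighted bounds).** Let `(A_i)_{i ∈ ι}`
be a finite family of operators on a complex vector space `V`, closed under commutators with real
structure constants bounded by `c`, `Δ = ∑ A_i²`; let `M_m : V → H` (`m ∈ ℕ`) be linear maps into
an inner product space which are monotone (`‖M_{m+1} f‖ ≤ ‖M_m f‖`) and almost skew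
(`|⟪M_m (A_i f), M_m g⟫ + ⟪M_m f, M_m (A_i g)⟫| ≤ D (m+1) ‖M_{m-1} f‖ ‖M_m g‖` for `m ≥ 1`); let
`T ≤ V` be `Δ`-stable and `N ≥ 0` on `T` with `‖M_0 w‖ ≤ N w` and `N (Δ w) ≤ B N w` on `T`.
Then for every word `α` of length `n ≤ m` and every `w ∈ T`,
`‖M_m (A_α w)‖ ≤ aprioriBound B c d D n m · N w`. In words: the weighted norms of *all*
derivatives of the elements of `T` are finite and controlled by the size of the elements
themselves. Nelson 1959, §6 (the `Δ`-finite case, with cut-offs). [folklore] -/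
theorem norm_weight_wordEnd_le (A : ι → Module.End ℂ V) (c : ι → ι → ι → ℝ)
    (hbr : ∀ i m, A i * A m - A m * A i = ∑ l, (c i m l : ℂ) • A l) {cM : ℝ} (hcM : 0 ≤ cM)
    (hc : ∀ i m l, |c i m l| ≤ cM) (M : ℕ → V →ₗ[ℂ] H)
    (hmono : ∀ (m : ℕ) (f : V), ‖M (m + 1) f‖ ≤ ‖M m f‖) {D : ℝ} (hD : 0 ≤ D)
    (hdef : ∀ m : ℕ, 1 ≤ m → ∀ (i : ι) (f g : V),
      ‖⟪M m (A i f), M m g⟫_ℂ + ⟪M m f, M m (A i g)⟫_ℂ‖ ≤ D * (m + 1) * ‖M (m - 1) f‖ * ‖M m g‖)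
    {T : Submodule ℂ V} (hT : ∀ w ∈ T, laplacianEnd A w ∈ T) (N : V → ℝ)
    (hN : ∀ w ∈ T, 0 ≤ N w) (hNM : ∀ w ∈ T, ‖M 0 w‖ ≤ N w) {B : ℝ} (hB0 : 0 ≤ B)
    (hB : ∀ w ∈ T, N (laplacianEnd A w) ≤ B * N w)
    (α : List ι) (m : ℕ) (hαm : α.length ≤ m) {w : V} (hw : w ∈ T) :
    ‖M m (wordEnd A α w)‖ ≤ aprioriBound B cM (Fintype.card ι) D α.length m * N w := by
  -- monotonicity in the weight, iterated
  have hmono' : ∀ (k m : ℕ) (f : V), k ≤ m → ‖M m f‖ ≤ ‖M k f‖ := by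
    intro k m f hkm
    induction m, hkm using Nat.le_induction with
    | base => exact le_rfl
    | succ m _ ih => exact (hmono m f).trans ih
  -- the claim for all lengths and weights, by induction on the length
  have main : ∀ n (α : List ι), α.length = n → ∀ m, n ≤ m → ∀ w ∈ T,
      ‖M m (wordEnd A α w)‖ ≤ aprioriBound B cM (Fintype.card ι) D n m * N w := by
    intro n
    induction n with
    | zero =>
      intro α hα m _ w hw
      rw [List.length_eq_zero_iff.mp hα]
      simpa [aprioriBound] using (hmono' 0 m w (Nat.zero_le m)).trans (hNM w hw)
    | succ n ih =>
      intro β hβ m hm w hw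
      have h := norm_weight_wordEnd_succ_le A c hbr hc M hD hdef hT N hN hB0 hB hm
        (aprioriBound_nonneg hcM hD _ n m) (aprioriBound_nonneg hcM hD _ n (m - 1))
        (fun α hα w hw ↦ ih α hα m (by omega) w hw)
        (fun α hα w hw ↦ ih α hα (m - 1) (by omega) w hw) β hβ hw
      simpa only [aprioriBound, mul_assoc] using h
  exact main α.length α rfl m hαm w hw

end Literature.Analysis.OperatorTheory
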